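import Mathlib
import HarnessLib
import Summits.NavierStokesRegularity.NavierStokesRegularity.Theorems.PoloidalWindowDoorPoloidalWindowRigidityEllipticThreadEmpty
import Summits.NavierStokesRegularity.NavierStokesRegularity.Theorems.PoloidalWindowDoorLrcModEntireTwistingTHRidgeChain

/-!
# Item `LrcModEntire` (stmt-NavierStokesRegularity-20428), registry twist_split v7 — THE SLOPE OF A (TH) THREAD PLANE IS NON-POSITIVE (memo `Cruxes/LrcModEntire/T2B-g14.md` §13c):
# the sub-cell «`μ₀ > 0`» of `stub_T2b` is EMPTY by the strong maximum principle, with NO non-degeneracy assumption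

LEAD of item 20428 ns-poloidal-K2-p3 g14 (`--supports stmt-NavierStokesRegularity-20428 --as helper`).  In the (TH) column the vertical shear is slaved to the horizontal
gradient of `v₂` near the thread plane, `∂_z v_b = μ(t, y₂) ∂_b v₂` (`b = 0, 1`), with a continuous slope function `μ`.  If `μ₀ := μ(−1, 0) > 0` then on a small ball round the
hot spot the slice `v(−1,·)` satisfies the hypotheses (REG) `|∂_z vₕ|² ≤ L₁|∇ₕv₂|²` and (ELL) `L₀|∇ₕv₂|² ≤ ∂_z vₕ·∇ₕv₂` (`L₀ = μ₀/2`) of K2-p2's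
`…PoloidalWindowRigidityEllipticThreadEmpty.stub_ellipticThreadEmpty` (the thread sits in a regular SUBSONIC core: `σv₂(−1,·)` is a `C¹` weak solution of the uniformly
elliptic `div(diag(μ,μ,1)∇u) = 0` attaining its maximum `|N|` at the centre; Gilbarg–Trudinger Thm 8.19 = `Literature.Analysis.PDE.divFormStrongMaximumPrinciple_holds` makes it
constant, contradicting `N ≠ 0` under the Type-I decay) — so that theorem returns `False`.

* `slopeFunction_nonpos` — class clauses + poloidality + `N ≠ 0` + hot-spot normalisation + a continuous slope function valid near `((−1), 0)` ⇒ **`μ(−1, 0) ≤ 0`**.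
  This removes the hypothesis `N·Δₕv₂(−1,0) < 0` of `…TwistingTHHotSpotSlope.hotSpot_slope_nonpos`: the slope sign needs NO transversal non-degeneracy of the ridge, and the
  sub-cells «`μ₀ = 1`» / «`μ₀ > 0`» of T2b (memo §3 (R-c′), §13c) are EMPTY outright.
* `slopeRatio_ne_one` — at any point `y₁ ∈ P₀` with `∂_{c₁}v₂(−1,y₁) ≠ 0` the (TH) ratio `∂₂v_{c₁}/∂_{c₁}v₂ ≠ 1` (it is `≤ 0`), from the GLOBAL bilinear (TH) clause `hTH` of the
  binder (via `…TwistingTHSlopeFunction.exists_slopeFunction_near_plane`).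
* `quasiconvexOn_sq_nuZ_of_T2bData'` — `…TwistingTHRidgeChain.quasiconvexOn_sq_nuZ_of_T2bData` with its hypothesis `hμ1` DISCHARGED.

WHAT THIS IS NOT: not a claim about Navier–Stokes regularity and not a proof of `stub_T2b` — one sub-cell of it closed by name and one hypothesis of the ridge chain removed
(bears_on LADDER-NS N0, item 20428 / crux 19708; both OPEN, ⟨27893⟩ OPEN).
-/

set_option linter.style.longLine false
set_option linter.dupNamespace false

namespace Summit.NavierStokesRegularity.NavierStokesRegularity.Theorems.PoloidalWindowDoorLrcModEntireTwistingTHSlopeSign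

open Set Function Filter Topology Metric
open scoped RealInnerProductSpace InnerProductSpace ContDiff
open Literature.Analysis Literature.Analysis.FluidPDE Literature.Analysis.UnboundedOperators
open Summit.NavierStokesRegularity.NavierStokesRegularity.Theorems
open Summit.NavierStokesRegularity.NavierStokesRegularity.Theorems.PoloidalWindowDoorPoloidalWindowRigidityEllipticThreadEmpty
open Summit.NavierStokesRegularity.NavierStokesRegularity.Theorems.PoloidalWindowDoorLrcModEntireTwistingTHSlopeFunction
open Summit.NavierStokesRegularity.NavierStokesRegularity.Theorems.PoloidalWindowDoorLrcModEntireTwistingTHRidgeChain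

variable {C : ℝ} {v : ℝ → EuclideanSpace ℝ (Fin 3) → EuclideanSpace ℝ (Fin 3)}

/-- **The slope of a (TH) thread plane is non-positive.**  Class profile, poloidal, `N = v₂(−1,0) ≠ 0`, hot-spot normalisation `√(−t)|v₂| ≤ |N|`, and a continuous slope function
`μ` with `∂_z v_b = μ(t, y₂)∂_b v₂` (`b ≠ 2`) near `((−1), 0)`: then `μ(−1, 0) ≤ 0` — otherwise the hot spot sits in a regular elliptic core, which
`…EllipticThreadEmpty.stub_ellipticThreadEmpty` (strong maximum principle) empties. -/
theorem slopeFunction_nonpos (hdec : HasTypeITimeDecay C v) (hcont : ContinuousOn (uncurry v) (Iio (0 : ℝ) ×ˢ univ))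
    (hmild : ∀ s t : ℝ, s < t → t < 0 → ∀ x, v t x = heatExtension (v s) (t - s) x - oseenDuhamel 1 s v v t x)
    (hdiv : ∀ t < 0, VectorCalculus.IsDivFree (v t))
    (hpol : ∀ s < 0, ∀ y, ⟪curl (v s) y, EuclideanSpace.single 2 1⟫_ℝ = 0)
    (hne : v (-1) 0 2 ≠ 0) (hhot : ∀ t < 0, ∀ x, Real.sqrt (-t) * |v t x 2| ≤ |v (-1) 0 2|)
    {μ : ℝ → ℝ → ℝ} (hμc : Continuous (uncurry μ))
    (hslope : ∀ᶠ z in 𝓝 (((-1 : ℝ), (0 : EuclideanSpace ℝ (Fin 3))) : ℝ × EuclideanSpace ℝ (Fin 3)), ∀ b : Fin 3, b ≠ 2 →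
      fderiv ℝ (v z.1) z.2 (EuclideanSpace.single 2 1) b = μ z.1 (z.2 2) * fderiv ℝ (v z.1) z.2 (EuclideanSpace.single b 1) 2) :
    μ (-1) 0 ≤ 0 := by
  by_contra hpos
  rw [not_le] at hpos
  set μ₀ : ℝ := μ (-1) 0 with hμ₀
  -- the slope relation on the slice `t = -1`, near `0`
  have h0 : ∀ᶠ z in 𝓝 (-1 : ℝ) ×ˢ 𝓝 (0 : EuclideanSpace ℝ (Fin 3)), ∀ b : Fin 3, b ≠ 2 →
      fderiv ℝ (v z.1) z.2 (EuclideanSpace.single 2 1) b = μ z.1 (z.2 2) * fderiv ℝ (v z.1) z.2 (EuclideanSpace.single b 1) 2 := by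
    rwa [← nhds_prod_eq]
  have h1 : ∀ᶠ y in 𝓝 (0 : EuclideanSpace ℝ (Fin 3)), ∀ b : Fin 3, b ≠ 2 →
      fderiv ℝ (v (-1)) y (EuclideanSpace.single 2 1) b = μ (-1) (y 2) * fderiv ℝ (v (-1)) y (EuclideanSpace.single b 1) 2 :=
    h0.curry.self_of_nhds
  -- continuity of `y ↦ μ(−1, y₂)` at `0`
  have hμy : Continuous fun y : EuclideanSpace ℝ (Fin 3) => μ (-1) (y 2) :=
    hμc.comp (continuous_const.prodMk (EuclideanSpace.proj (2 : Fin 3)).continuous)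
  have h2 : ∀ᶠ y in 𝓝 (0 : EuclideanSpace ℝ (Fin 3)), μ (-1) (y 2) ∈ Ioo (μ₀ / 2) (2 * μ₀) := by
    have hc : ContinuousAt (fun y : EuclideanSpace ℝ (Fin 3) => μ (-1) (y 2)) 0 := hμy.continuousAt
    have hm : Ioo (μ₀ / 2) (2 * μ₀) ∈ 𝓝 (μ (-1) ((0 : EuclideanSpace ℝ (Fin 3)) 2)) := by
      have e0 : ((0 : EuclideanSpace ℝ (Fin 3)) 2) = 0 := rfl
      rw [e0]
      exact Ioo_mem_nhds (by linarith) (by linarith)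
    exact hc.preimage_mem_nhds hm
  obtain ⟨δ, hδ, hball⟩ := Metric.eventually_nhds_iff.1 (h1.and h2)
  have hB : ∀ y : EuclideanSpace ℝ (Fin 3), ‖y‖ < δ →
      (fderiv ℝ (v (-1)) y (EuclideanSpace.single 2 1) 0 = μ (-1) (y 2) * fderiv ℝ (v (-1)) y (EuclideanSpace.single 0 1) 2 ∧
       fderiv ℝ (v (-1)) y (EuclideanSpace.single 2 1) 1 = μ (-1) (y 2) * fderiv ℝ (v (-1)) y (EuclideanSpace.single 1 1) 2) ∧
      μ₀ / 2 < μ (-1) (y 2) ∧ μ (-1) (y 2) < 2 * μ₀ := by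
    intro y hy
    have h := hball (y := y) (by rwa [dist_zero_right])
    exact ⟨⟨h.1 0 (by decide), h.1 1 (by decide)⟩, h.2.1, h.2.2⟩
  refine stub_ellipticThreadEmpty C v hdec hcont hmild hdiv hpol hne hhot ⟨δ, hδ, (2 * μ₀) ^ 2, fun y hy => ?_⟩ ⟨δ, hδ, μ₀ / 2, by linarith, fun y hy => ?_⟩
  · obtain ⟨⟨e0, e1⟩, hlo, hhi⟩ := hB y hy
    rw [e0, e1]
    have hG : 0 ≤ fderiv ℝ (v (-1)) y (EuclideanSpace.single 0 1) 2 ^ 2 + fderiv ℝ (v (-1)) y (EuclideanSpace.single 1 1) 2 ^ 2 := by positivity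
    have hsq : μ (-1) (y 2) ^ 2 ≤ (2 * μ₀) ^ 2 := by nlinarith
    calc (μ (-1) (y 2) * fderiv ℝ (v (-1)) y (EuclideanSpace.single 0 1) 2) ^ 2 + (μ (-1) (y 2) * fderiv ℝ (v (-1)) y (EuclideanSpace.single 1 1) 2) ^ 2
        = μ (-1) (y 2) ^ 2 * (fderiv ℝ (v (-1)) y (EuclideanSpace.single 0 1) 2 ^ 2 + fderiv ℝ (v (-1)) y (EuclideanSpace.single 1 1) 2 ^ 2) := by ring
      _ ≤ (2 * μ₀) ^ 2 * (fderiv ℝ (v (-1)) y (EuclideanSpace.single 0 1) 2 ^ 2 + fderiv ℝ (v (-1)) y (EuclideanSpace.single 1 1) 2 ^ 2) :=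
          mul_le_mul_of_nonneg_right hsq hG
  · obtain ⟨⟨e0, e1⟩, hlo, hhi⟩ := hB y hy
    rw [e0, e1]
    have hG : 0 ≤ fderiv ℝ (v (-1)) y (EuclideanSpace.single 0 1) 2 ^ 2 + fderiv ℝ (v (-1)) y (EuclideanSpace.single 1 1) 2 ^ 2 := by positivity
    calc μ₀ / 2 * (fderiv ℝ (v (-1)) y (EuclideanSpace.single 0 1) 2 ^ 2 + fderiv ℝ (v (-1)) y (EuclideanSpace.single 1 1) 2 ^ 2)
        ≤ μ (-1) (y 2) * (fderiv ℝ (v (-1)) y (EuclideanSpace.single 0 1) 2 ^ 2 + fderiv ℝ (v (-1)) y (EuclideanSpace.single 1 1) 2 ^ 2) :=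
          mul_le_mul_of_nonneg_right hlo.le hG
      _ = μ (-1) (y 2) * fderiv ℝ (v (-1)) y (EuclideanSpace.single 0 1) 2 * fderiv ℝ (v (-1)) y (EuclideanSpace.single 0 1) 2 +
          μ (-1) (y 2) * fderiv ℝ (v (-1)) y (EuclideanSpace.single 1 1) 2 * fderiv ℝ (v (-1)) y (EuclideanSpace.single 1 1) 2 := by ring

/-- **The (TH) ratio is never `1` (it is `≤ 0`).**  Under the class clauses, poloidality, `N ≠ 0`, the hot-spot normalisation and the GLOBAL bilinear (TH) clause `hTH` of the
binder: at a point `y₁ ∈ P₀` with `∂_{c₁}v₂(−1,y₁) ≠ 0` (`c₁ ≠ 2`), `∂₂v_{c₁}(−1,y₁) ≠ ∂_{c₁}v₂(−1,y₁)` — the hypothesis `hμ1` of `…TwistingTHRidgeChain`. -/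
theorem slopeRatio_ne_one (hdec : HasTypeITimeDecay C v) (hcont : ContinuousOn (uncurry v) (Iio (0 : ℝ) ×ˢ univ))
    (hmild : ∀ s t : ℝ, s < t → t < 0 → ∀ x, v t x = heatExtension (v s) (t - s) x - oseenDuhamel 1 s v v t x)
    (hdiv : ∀ t < 0, VectorCalculus.IsDivFree (v t))
    (hpol : ∀ s < 0, ∀ y, ⟪curl (v s) y, EuclideanSpace.single 2 1⟫_ℝ = 0)
    (hTH : ∀ t < 0, ∀ x x' : EuclideanSpace ℝ (Fin 3), x 2 = x' 2 → ∀ b c : Fin 3, b ≠ 2 → c ≠ 2 →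
      fderiv ℝ (v t) x (EuclideanSpace.single 2 1) b * fderiv ℝ (v t) x' (EuclideanSpace.single c 1) 2 =
        fderiv ℝ (v t) x' (EuclideanSpace.single 2 1) c * fderiv ℝ (v t) x (EuclideanSpace.single b 1) 2)
    (hne : v (-1) 0 2 ≠ 0) (hhot : ∀ t < 0, ∀ x, Real.sqrt (-t) * |v t x 2| ≤ |v (-1) 0 2|)
    {y₁ : EuclideanSpace ℝ (Fin 3)} (hy₁ : y₁ 2 = 0) {c₁ : Fin 3} (hc₁ : c₁ ≠ 2)
    (hne₁ : fderiv ℝ (v (-1)) y₁ (EuclideanSpace.single c₁ 1) 2 ≠ 0) :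
    fderiv ℝ (v (-1)) y₁ (EuclideanSpace.single 2 1) c₁ ≠ fderiv ℝ (v (-1)) y₁ (EuclideanSpace.single c₁ 1) 2 := by
  obtain ⟨μ, hμ, hslope, hμ0⟩ := exists_slopeFunction_near_plane hdec hcont hmild hTH hy₁ hc₁ hne₁
  have hle : μ (-1) 0 ≤ 0 := slopeFunction_nonpos hdec hcont hmild hdiv hpol hne hhot hμ.continuous (hslope 0 rfl)
  intro h
  have h1 : μ (-1) 0 = 1 := by rw [hμ0, h, div_self hne₁]
  linarith

/-- **THE RIDGE CHAIN with `hμ1` discharged**: `…TwistingTHRidgeChain.quasiconvexOn_sq_nuZ_of_T2bData` without the slope hypothesis at `y₁`.  See that file's module docstring for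
the remaining (binder-level and geometric) hypotheses. -/
theorem quasiconvexOn_sq_nuZ_of_T2bData' (hdec : HasTypeITimeDecay C v) (hcont : ContinuousOn (uncurry v) (Iio (0 : ℝ) ×ˢ univ))
    (hmild : ∀ s t : ℝ, s < t → t < 0 → ∀ x, v t x = heatExtension (v s) (t - s) x - oseenDuhamel 1 s v v t x)
    (hdiv : ∀ t < 0, VectorCalculus.IsDivFree (v t))
    (hpol : ∀ s < 0, ∀ y, ⟪curl (v s) y, EuclideanSpace.single 2 1⟫_ℝ = 0)
    (hTH : ∀ t < 0, ∀ x x' : EuclideanSpace ℝ (Fin 3), x 2 = x' 2 → ∀ b c : Fin 3, b ≠ 2 → c ≠ 2 →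
      fderiv ℝ (v t) x (EuclideanSpace.single 2 1) b * fderiv ℝ (v t) x' (EuclideanSpace.single c 1) 2 =
        fderiv ℝ (v t) x' (EuclideanSpace.single 2 1) c * fderiv ℝ (v t) x (EuclideanSpace.single b 1) 2)
    (hpk : ∀ (s z₀ σ M : ℝ) (K O : Set (EuclideanSpace ℝ (Fin 3))), s < 0 →
      ((σ = 1 ∨ σ = -1) ∧ IsCompact K ∧ K.Nonempty ∧ (∀ y ∈ K, y 2 = z₀ ∧ σ * v s y 2 = M) ∧
        IsOpen O ∧ K ⊆ O ∧ (∀ y ∈ O, y 2 = z₀ → σ * v s y 2 ≤ M) ∧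
        (∀ y ∈ O, y 2 = z₀ → σ * v s y 2 = M → y ∈ K)) → False)
    (hcrit : ∀ y ∈ {y : EuclideanSpace ℝ (Fin 3) | y 2 = 0 ∧ v (-1) y 2 = v (-1) 0 2}, fderiv ℝ (fun x => v (-1) x 2) y = 0)
    (hne : v (-1) 0 2 ≠ 0) (hhot : ∀ t < 0, ∀ x, Real.sqrt (-t) * |v t x 2| ≤ |v (-1) 0 2|)
    {y₁ : EuclideanSpace ℝ (Fin 3)} (hy₁ : y₁ 2 = 0) {c₁ : Fin 3} (hc₁ : c₁ ≠ 2)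
    (hne₁ : fderiv ℝ (v (-1)) y₁ (EuclideanSpace.single c₁ 1) 2 ≠ 0)
    {C₃ : ℝ} (hC₃ : ∀ x, ‖iteratedFDeriv ℝ 3 (v (-1)) x‖ ≤ C₃)
    {σ : ℝ} (hσ : σ = 1 ∨ σ = -1)
    (e : OpenPartialHomeomorph (ℝ × ℝ) (ℝ × ℝ)) {a₁ a₂ r : ℝ} (ha : a₁ ≤ a₂) (hr : 0 < r) (hsrc : Icc a₁ a₂ ×ˢ Icc (-r) r ⊆ e.source)
    {P : ℝ → ℝ × ℝ → EuclideanSpace ℝ (Fin 3)} (hP : ∀ z₀ q, P z₀ q = WithLp.toLp 2 ![q.1, q.2, z₀])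
    {I : Set ℝ} (hI : IsOpen I) (hIcc : Icc a₁ a₂ ⊆ I) {γ ν : ℝ → EuclideanSpace ℝ (Fin 3)} {a b c : ℝ → ℝ}
    (hab : ∀ s ∈ I, a s ^ 2 + b s ^ 2 = 1) (hc : ∀ s ∈ I, c s ≠ 0)
    (hγ : ∀ s ∈ I, HasDerivAt γ (c s • (-b s • EuclideanSpace.single 0 (1 : ℝ) + a s • EuclideanSpace.single 1 (1 : ℝ))) s)
    (hγhot : ∀ s ∈ I, γ s 2 = 0 ∧ v (-1) (γ s) 2 = v (-1) 0 2)
    (hνab : ∀ s ∈ I, ν s = a s • EuclideanSpace.single 0 1 + b s • EuclideanSpace.single 1 1)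
    (hγν : ∀ s ∈ Icc a₁ a₂, ∀ n z : ℝ, P z (e (s, n)) = γ s + n • ν s + z • EuclideanSpace.single 2 1)
    (hlat0 : ∀ a ∈ Icc a₁ a₂, ∀ n : ℝ, (n = r ∨ n = -r) → σ * v (-1) (P 0 (e (a, n))) 2 < σ * v (-1) 0 2)
    (hκ0 : 0 < -(fderiv ℝ (fderiv ℝ (fun y => σ * v (-1) y 2)) (γ a₁) (ν a₁) (ν a₁)))
    (hthin : 64 * C₃ * r ≤ -(fderiv ℝ (fderiv ℝ (fun y => σ * v (-1) y 2)) (γ a₁) (ν a₁) (ν a₁))) :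
    QuasiconvexOn ℝ (Icc a₁ a₂) fun s =>
      (fderiv ℝ (fderiv ℝ (fun y => σ * v (-1) y 2)) (γ s) (ν s) (EuclideanSpace.single 2 1)) ^ 2 :=
  quasiconvexOn_sq_nuZ_of_T2bData hdec hcont hmild hdiv hpol hTH hpk hcrit hne hhot hy₁ hc₁ hne₁
    (slopeRatio_ne_one hdec hcont hmild hdiv hpol hTH hne hhot hy₁ hc₁ hne₁) hC₃ hσ e ha hr hsrc hP hI hIcc hab hc hγ hγhot hνab hγν hlat0 hκ0 hthin

end Summit.NavierStokesRegularity.NavierStokesRegularity.Theorems.PoloidalWindowDoorLrcModEntireTwistingTHSlopeSign
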